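import Summits.QuantumFields.YangMills.Theorems.QuantileBitPuritySectorTranslate
import HarnessLib

/-!
# The density of a seam sector in closed Boltzmann form, and the cost of a translate as ONE exponential

Support module (`--supports` stmt-QuantumFields-23948; memo HOME `bc/g14-dw/PLAN-PERIODIC.md` §B).  The sector density of `TT.sectorWeight β n z`
(`Theorems/QuantileBitPuritySectorTranslate.lean`) is

  `w_z(U⃗, g) = ∏_{i<n} K_β(U_i, U_{i+1}) · K_β(U_n, g·tw_z U_0) = exp( β·[Σ_{i<n} T(U_i,U_{i+1}) + T(U_n, g·tw_z U_0)] − β·Σ_{t ≤ n} S(U_t) )`,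

`T` = the time-like coupling, `S` = the spatial Wilson action (gauge and centre-twist invariant, so the seam's `S(g·tw_z U_0) = S(U_0)` and every slice's
action is counted exactly once).  Hence the hypothesis of the translate lemmas `TT.sectorWeight_indicator_le_of_translate` ∕ `_of_paired_translates`
(`w_z ≤ C · w_z∘Φ` on the event) is ONE inequality between exponents: ★ `seamDensity_le_mul_of_exponent_le` — if
`(total coupling − total action)(U⃗) − (total coupling − total action)(Φ U⃗) ≤ Q/β` then `w_z(U⃗) ≤ e^{Q} · w_z(Φ U⃗)`.
HONEST FRAMING: algebra of the Boltzmann weight; no estimate; nothing about infinite volume, the continuum limit or the Clay gap.  No `sorry`, no new axiom,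
no new definition.  References: [cite: SeilerLNP1982, §3]; [cite: Luscher1983, §2].
-/

set_option autoImplicit false

noncomputable section

open MeasureTheory Real Function
open scoped BigOperators
open Literature.MathematicalPhysics.QuantumLattice
open Literature.MathematicalPhysics.QuantumFieldTheory hiding SU2
open Summit.QuantumFields.YangMills.Theorems

namespace Summit.QuantumFields.YangMills.Theorems.FemtoTransferGap.TT

open Summit.QuantumFields.YangMills.Theorems.FemtoTransferGap

variable {L : ℕ} [NeZero L]

/-- The spatial action of the seam's right slot is that of slice `0`: `S(g · tw_z U) = S(U)`. [cite: tHooft1979] [cite: SeilerLNP1982, §3] -/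
theorem wilsonAction_act (g : Site 3 L → SU2) (z : Fin 3 → Bool) (U : GaugeConfig 3 L SU2) :
    wilsonAction su2Rep (gaugeTransform g (twist3 z U)) = wilsonAction su2Rep U := by
  rw [wilsonAction_gaugeTransform]
  simp only [twist3]
  rw [wilsonAction_twist_of_mem_center su2Rep 0 (centreElem_mem_center _), wilsonAction_twist_of_mem_center su2Rep 1 (centreElem_mem_center _),
    wilsonAction_twist_of_mem_center su2Rep 2 (centreElem_mem_center _)]

/-- The open chain in Boltzmann form: `∏_{i<n} K_β(U_i,U_{i+1}) = exp(Σ_{i<n} [β T(U_i,U_{i+1}) − (β/2)(S(U_i) + S(U_{i+1}))])`. [cite: SeilerLNP1982, §3] -/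
theorem prod_transferKernel_eq_exp (β : ℝ) {n : ℕ} (Us : Fin (n + 1) → GaugeConfig 3 L SU2) :
    (∏ i : Fin n, transferKernel su2Rep β (Us i.castSucc) (Us i.succ)) =
      Real.exp (∑ i : Fin n, (β * timeCoupling su2Rep (Us i.castSucc) (Us i.succ) -
        (β / 2) * (wilsonAction su2Rep (Us i.castSucc) + wilsonAction su2Rep (Us i.succ)))) := by
  rw [Real.exp_sum]
  rfl

/-- **Half-action telescoping**: `Σ_{i<n} (S(U_i) + S(U_{i+1}))/2 + (S(U_n) + S(U_0))/2 = Σ_{t ≤ n} S(U_t)` — along the closed ring every slice's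
action is counted exactly once. [folklore] -/
theorem sum_half_actions_eq {n : ℕ} (S : Fin (n + 1) → ℝ) :
    (∑ i : Fin n, (S i.castSucc + S i.succ) / 2) + (S (Fin.last n) + S 0) / 2 = ∑ t : Fin (n + 1), S t := by
  have h1 : ∑ i : Fin n, S i.castSucc = (∑ t : Fin (n + 1), S t) - S (Fin.last n) := by
    rw [Fin.sum_univ_castSucc]; ring
  have h2 : ∑ i : Fin n, S i.succ = (∑ t : Fin (n + 1), S t) - S 0 := by
    rw [Fin.sum_univ_succ]; ring
  have h3 : ∑ i : Fin n, (S i.castSucc + S i.succ) / 2 = ((∑ i : Fin n, S i.castSucc) + ∑ i : Fin n, S i.succ) / 2 := by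
    rw [← Finset.sum_add_distrib, Finset.sum_div]
  rw [h3, h1, h2]
  ring

/-- ★ **The sector density in closed Boltzmann form**:
`w_z(U⃗, g) = exp( β·(Σ_{i<n} T(U_i,U_{i+1}) + T(U_n, g·tw_z U_0)) − β·Σ_{t≤n} S(U_t) )`. [cite: SeilerLNP1982, §3] [cite: Luscher1983, §2] -/
theorem seamDensity_eq_exp (β : ℝ) {n : ℕ} (z : Fin 3 → Bool) (Us : Fin (n + 1) → GaugeConfig 3 L SU2) (g : Site 3 L → SU2) :
    (∏ i : Fin n, transferKernel su2Rep β (Us i.castSucc) (Us i.succ)) *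
        transferKernel su2Rep β (Us (Fin.last n)) (gaugeTransform g (twist3 z (Us 0))) =
      Real.exp (β * ((∑ i : Fin n, timeCoupling su2Rep (Us i.castSucc) (Us i.succ)) +
          timeCoupling su2Rep (Us (Fin.last n)) (gaugeTransform g (twist3 z (Us 0)))) -
        β * ∑ t : Fin (n + 1), wilsonAction su2Rep (Us t)) := by
  rw [prod_transferKernel_eq_exp]
  simp only [transferKernel]
  rw [← Real.exp_add, wilsonAction_act]
  congr 1
  have h := sum_half_actions_eq (fun t : Fin (n + 1) => wilsonAction su2Rep (Us t))
  rw [← h, Finset.sum_sub_distrib]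
  have r1 : β * ((∑ i : Fin n, timeCoupling su2Rep (Us i.castSucc) (Us i.succ)) +
      timeCoupling su2Rep (Us (Fin.last n)) (gaugeTransform g (twist3 z (Us 0)))) =
      (∑ i : Fin n, β * timeCoupling su2Rep (Us i.castSucc) (Us i.succ)) + β * timeCoupling su2Rep (Us (Fin.last n)) (gaugeTransform g (twist3 z (Us 0))) := by
    rw [mul_add, Finset.mul_sum]
  have r2 : β * ((∑ i : Fin n, (wilsonAction su2Rep (Us i.castSucc) + wilsonAction su2Rep (Us i.succ)) / 2) +
      (wilsonAction su2Rep (Us (Fin.last n)) + wilsonAction su2Rep (Us 0)) / 2) =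
      (∑ i : Fin n, β / 2 * (wilsonAction su2Rep (Us i.castSucc) + wilsonAction su2Rep (Us i.succ))) +
        β / 2 * (wilsonAction su2Rep (Us (Fin.last n)) + wilsonAction su2Rep (Us 0)) := by
    rw [mul_add, Finset.mul_sum]
    congr 1
    · exact Finset.sum_congr rfl fun i _ => by ring
    · ring
  rw [r1, r2]
  ring

/-- ★ **The cost of a translate as one exponent**: if the «total time coupling minus total action» of `(U⃗, g)` exceeds that of `(U⃗', g)` by at most
`Q/β`-worth, precisely `β·ΔT − β·ΔS ≤ Q`, then `w_z(U⃗, g) ≤ e^{Q} · w_z(U⃗', g)` — the hypothesis `hcost` of `TT.sectorWeight_indicator_le_of_translate` with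
`C = e^{Q}` and `U⃗' = Φ_g U⃗`. [cite: Luscher1983, §2] -/
theorem seamDensity_le_exp_mul (β : ℝ) {n : ℕ} (z : Fin 3 → Bool) (Us Us' : Fin (n + 1) → GaugeConfig 3 L SU2) (g : Site 3 L → SU2) {Q : ℝ}
    (hQ : (β * ((∑ i : Fin n, timeCoupling su2Rep (Us i.castSucc) (Us i.succ)) +
            timeCoupling su2Rep (Us (Fin.last n)) (gaugeTransform g (twist3 z (Us 0)))) -
          β * ∑ t : Fin (n + 1), wilsonAction su2Rep (Us t)) -
        (β * ((∑ i : Fin n, timeCoupling su2Rep (Us' i.castSucc) (Us' i.succ)) +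
            timeCoupling su2Rep (Us' (Fin.last n)) (gaugeTransform g (twist3 z (Us' 0)))) -
          β * ∑ t : Fin (n + 1), wilsonAction su2Rep (Us' t)) ≤ Q) :
    (∏ i : Fin n, transferKernel su2Rep β (Us i.castSucc) (Us i.succ)) *
        transferKernel su2Rep β (Us (Fin.last n)) (gaugeTransform g (twist3 z (Us 0))) ≤
      Real.exp Q * ((∏ i : Fin n, transferKernel su2Rep β (Us' i.castSucc) (Us' i.succ)) *
        transferKernel su2Rep β (Us' (Fin.last n)) (gaugeTransform g (twist3 z (Us' 0)))) := by
  rw [seamDensity_eq_exp, seamDensity_eq_exp, ← Real.exp_add]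
  exact Real.exp_le_exp.2 (by linarith)

/-- **The ± paired form**: if the two translates `U⃗⁺, U⃗⁻` have exponent changes `−ℓ − q⁺` and `ℓ − q⁻` relative to `U⃗` with `q^± ≤ Q` (the odd part `ℓ`
arbitrary), then `2 w_z(U⃗) ≤ e^{Q} (w_z(U⃗⁺) + w_z(U⃗⁻))` — the hypothesis `hcost` of `TT.sectorWeight_indicator_le_of_paired_translates`. [cite: Luscher1983, §2] -/
theorem two_mul_seamDensity_le_exp_mul_add (β : ℝ) {n : ℕ} (z : Fin 3 → Bool) (Us Up Um : Fin (n + 1) → GaugeConfig 3 L SU2) (g : Site 3 L → SU2)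
    {ℓ qp qm Q : ℝ} (hqp : qp ≤ Q) (hqm : qm ≤ Q)
    (hp : (β * ((∑ i : Fin n, timeCoupling su2Rep (Up i.castSucc) (Up i.succ)) +
            timeCoupling su2Rep (Up (Fin.last n)) (gaugeTransform g (twist3 z (Up 0)))) -
          β * ∑ t : Fin (n + 1), wilsonAction su2Rep (Up t)) =
        (β * ((∑ i : Fin n, timeCoupling su2Rep (Us i.castSucc) (Us i.succ)) +
            timeCoupling su2Rep (Us (Fin.last n)) (gaugeTransform g (twist3 z (Us 0)))) -
          β * ∑ t : Fin (n + 1), wilsonAction su2Rep (Us t)) + (-ℓ - qp))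
    (hm : (β * ((∑ i : Fin n, timeCoupling su2Rep (Um i.castSucc) (Um i.succ)) +
            timeCoupling su2Rep (Um (Fin.last n)) (gaugeTransform g (twist3 z (Um 0)))) -
          β * ∑ t : Fin (n + 1), wilsonAction su2Rep (Um t)) =
        (β * ((∑ i : Fin n, timeCoupling su2Rep (Us i.castSucc) (Us i.succ)) +
            timeCoupling su2Rep (Us (Fin.last n)) (gaugeTransform g (twist3 z (Us 0)))) -
          β * ∑ t : Fin (n + 1), wilsonAction su2Rep (Us t)) + (ℓ - qm)) :
    2 * ((∏ i : Fin n, transferKernel su2Rep β (Us i.castSucc) (Us i.succ)) *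
        transferKernel su2Rep β (Us (Fin.last n)) (gaugeTransform g (twist3 z (Us 0)))) ≤
      Real.exp Q * ((∏ i : Fin n, transferKernel su2Rep β (Up i.castSucc) (Up i.succ)) *
          transferKernel su2Rep β (Up (Fin.last n)) (gaugeTransform g (twist3 z (Up 0))) +
        (∏ i : Fin n, transferKernel su2Rep β (Um i.castSucc) (Um i.succ)) *
          transferKernel su2Rep β (Um (Fin.last n)) (gaugeTransform g (twist3 z (Um 0)))) := by
  rw [seamDensity_eq_exp, seamDensity_eq_exp, seamDensity_eq_exp, hp, hm]
  set E := β * ((∑ i : Fin n, timeCoupling su2Rep (Us i.castSucc) (Us i.succ)) +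
      timeCoupling su2Rep (Us (Fin.last n)) (gaugeTransform g (twist3 z (Us 0)))) - β * ∑ t : Fin (n + 1), wilsonAction su2Rep (Us t) with hE
  rw [Real.exp_add, Real.exp_add]
  have h := Translate.two_mul_exp_neg_le_add (ℓ := ℓ) hqp hqm
  have hE0 := Real.exp_pos E
  -- `2 e^{E} ≤ e^{Q} (e^{E} e^{−ℓ−qp} + e^{E} e^{ℓ−qm})` from `2 e^{−Q} ≤ e^{−ℓ−qp} + e^{ℓ−qm}`
  have h2 : 2 * Real.exp E = Real.exp Q * (Real.exp E * (2 * Real.exp (-Q))) := by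
    rw [show Real.exp Q * (Real.exp E * (2 * Real.exp (-Q))) = 2 * Real.exp E * (Real.exp Q * Real.exp (-Q)) by ring, ← Real.exp_add,
      add_neg_cancel, Real.exp_zero, mul_one]
  rw [h2, ← mul_add]
  exact mul_le_mul_of_nonneg_left (mul_le_mul_of_nonneg_left h hE0.le) (Real.exp_pos _).le

end Summit.QuantumFields.YangMills.Theorems.FemtoTransferGap.TT

end
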